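import Literature.MathematicalPhysics.QuantumFieldTheory.King1986.UniformDecay
import Literature.MathematicalPhysics.QuantumFieldTheory.King1986.CovarianceRate
import Literature.MathematicalPhysics.QuantumFieldTheory.King1986.GaussianNormalizationRate

/-!
# King 1986, Lemma 4.5 ON THE TORUS for King's actual operators — the A = 0 covariance rate
# `|C^{(k)}(x,y) − C^{(k+n)}(x,y)| ≤ C L^{−k} e^{−δ₀|x−y|}` with NO typed input, constants explicit

CITATION HEADER.  C. King, *The U(1) Higgs model. I. The continuum limit*, Commun. Math. Phys. **102** (1986)
649–677 [bib `King1986`], p.674: *"Lemma 4.5. |C^{(k)}(x,y) − C^{(k+n)}(x,y)| ≤ CL^{−k}e^{−δ₀|x−y|}. (4.38)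
Proof. We prove (4.38) in a finite volume Ω with periodic boundary conditions …"*, with `C^{(k)}_Ω(s) = (sΔ^{(k)} +
(1−s)Δ^{(k+n)} + aL^{−2}Q*Q)^{−1}` (4.32), the decay conditions (4.33)–(4.34), the resolvent/interpolation identity
(4.39)–(4.40) and *"Combining Lemma 4.3 and the uniform exponential decay of Δ^{(k)} and C_Ω^{(k)}(s) gives |(4.40)| ≤
CL^{−k} Σ_{z,w∈Ω} exp[−δ₀|x−z| − δ₀|z−w| − δ₀|w−y|] ≤ CL^{−k}exp[−δ₀|x−y|]. (4.41)"* (p.675).  This module ASSEMBLES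
the cell's kernel reproductions of every ingredient into the printed statement for King's ACTUAL A = 0 operators on
every torus, with constants depending on `(a, L, d)` only:
(a) (4.33) = `EffectiveLaplacianSymbol.king433` (via (4.5) as an operator identity, `TorusBlockForm`, `EndpointCoercivity`);
(b) (4.34) = `UniformDecay.effLaplacian_entry_le` (Dimock's Lemmas 29–30 of [Dimock2013] App. D, for `Δ^{(k)}`) and
    `blockTerm_entry_le` (short range of `Q*Q`), turned into Combes–Thomas-summable weighted sums by
    `B4Sect5Torus.weightedRowSum_le`/`weightedColSum_le` ([Ba 4] Sect. 5 engine of the b04/pv09/pv23 lineages);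
(c) Lemma 4.3 = `CompositionLaw.lemma43_aK` for the symbols, here completed at the zero mode (`DeltaEff_zero`,
    `abs_DeltaEff_sub_le_thetaK`) and transported to the KERNELS by polarization + Parseval (§1,
    `abs_sub_apply_le_of_symbols`, `effLaplacian_sub_apply_le`);
(d) the lattice sums `B4Sect5Torus.torusSum_le` (`tdistT_sumBound`);
(e) the mechanism (4.39)–(4.41) = `CovarianceRate.lemma45_of_supRate`.
VALUE = kernel reproduction (the composed A = 0 statement of a printed, proved lemma), NOT summit progress: nothing
printed in Bałaban's papers (B4–B16, the manuscripts under audit in the cell `pub-balaban`) is quoted or certified;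
King's background-dependent and vector-field operators, free boundary conditions and the position-space Props 3.8/3.9
remain outside (TEMPLATE.md §18).

MAIN RESULTS (namespace `…King1986` / `…King1986.Torus`; 0 sorry).
* §1 `four_mul_apply_eq_polar`, `polar_norms`, **`abs_sub_apply_le_of_symbols`** (two symmetric operators on a torus
  with plane-wave forms `|Ω|⟨x,T_ix⟩ = Σ_q σ_i(q)|x̃(q)|²` and `|σ₁ − σ₀| ≤ ε` pointwise differ entrywise by `≤ ε`);
  §1b `DeltaEff_zero` (`Δ^{(k)}(0) = (a_k⁻¹ + m⁻²)⁻¹`), **`abs_DeltaEff_sub_le_thetaK`** (`|Δ^{(k)}(p′) − Δ^{(k+n)}(p′)|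
  ≤ θ_k·a` for ALL zone momenta incl. `0`, `θ_k = thetaK a L k n = 2a_k(a_n⁻¹ + π²/48 + 1/3)L^{−2k}`); §1c
  `effLaplacian_symm`, **`effLaplacian_sub_apply_le`** (`|Δ^{(k+n)}(z,w) − Δ^{(k)}(z,w)| ≤ θ_k·a` on every torus).
* §2 uniform constants over the run `a_k ∈ [a_min, a]`, `a_min = aminL a L = a(1 − L⁻²)`: `kapU`, `CDelU`,
  **`effLaplacian_entry_le_unif`** (`|Δ_{a₁,N}(b,b′)| ≤ C_U e^{−κ_U tdist}` for all `a_min ≤ a₁ ≤ a`, `N ≥ 1`),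
  `blockTerm_entry_le`.
* §3 the explicit constants `gam0L` (= `gamma0F L a_min a d`), `cB`, `kapCT` (= `B4Sect5Torus.rate …`), `V45`, `thetaBar`,
  `K45`, `delta45`, and **`king_lemma45_torus`**: for `L ≥ 2`, `k, n ≥ 1`, `a > 0`, `m² > 0`, every torus
  `Π ℤ/(LM_μ)` and all `x, y`,
  `|(Δ^{(k)} + aL⁻²Q*Q)⁻¹(x,y) − (Δ^{(k+n)} + aL⁻²Q*Q)⁻¹(x,y)| ≤ K₄₅(a,L,d)·L^{−k}·e^{−δ₄₅(a,L,d)·tdist(x,y)}`;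
  `king_lemma45_torus_exists` = the printed `∃ C, δ₀` shape.  `#print axioms` = {propext, Classical.choice, Quot.sound}.

SCOPE / NOT COVERED.  A = 0, periodic boundary conditions, flat block profile, `m² > 0` — King's §4 computes
exactly there (*"with free boundary conditions (and A = 0, of course)"*, p.670; the periodic case is the one he
proves (4.38) in, p.674); the transport to free boundary conditions *"by continuity"*/multiple reflections ([Ba 4]),
`A ≠ 0`, the vector field, and King's position-space Props 3.8/3.9 (K3/K4 of TEMPLATE.md §18.2) are not formalised.
The rate `δ₄₅` is of order `L⁻²·const(a,d)` (from `γ₀^F ~ L⁻²`), not optimised; Dimock's (Cbound) prints the same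
`L⁻²` phenomenon (`|C_k(Ω;y,y′)| ≤ O(1)L²e^{−δ₀L^{−2}d(y,y′)}`).

## References
* [King1986] C. King, Commun. Math. Phys. 102 (1986) 649–677 — (2.13)–(2.16) p.653, (4.5) p.670, Lemma 4.3 (4.18)
  p.672, (4.32)–(4.41) pp.674–675.
* [Dimock2013] J. Dimock, Rev. Math. Phys. 25 (2013) 1330010 = arXiv:1108.1335v2 — App. D Lemmas 29–30, (Cbound).
* [Balaban1983RegularityDecay] T. Bałaban, Commun. Math. Phys. 89 (1983) 571–597 — Sect. 5 (the engine of
  `B4Sect5Torus`, context).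
-/

noncomputable section

open Finset Real Matrix
open scoped BigOperators ComplexConjugate

namespace Literature.MathematicalPhysics.QuantumFieldTheory.King1986

open Literature.MathematicalPhysics.QuantumFieldTheory.Balaban1983to89
open Literature.MathematicalPhysics.QuantumFieldTheory.Balaban1983to89.B5Prop11Plancherel

/-! ## §1 From symbols to kernels: a sup-norm rate of the KERNEL of `Δ^{(k+n)} − Δ^{(k)}` from the rate of the
plane-wave symbols (Lemma 4.3 transported through (4.35)) -/

section Polarization

variable {n : Type*} [Fintype n] [DecidableEq n]

/-- `e_a ⬝ (T e_b) = T(a,b)`. [folklore] -/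
theorem single_dot_mulVec_single (T : Matrix n n ℝ) (a b : n) :
    Pi.single a (1 : ℝ) ⬝ᵥ (T *ᵥ Pi.single b 1) = T a b := by
  rw [single_dotProduct, one_mul, QGQInverse.mulVec_single_one_apply]

/-- **Polarization**: for a symmetric real matrix, `4T(a,b) = ⟨e_a+e_b, T(e_a+e_b)⟩ − ⟨e_a−e_b, T(e_a−e_b)⟩`.
[folklore] -/
theorem four_mul_apply_eq_polar (T : Matrix n n ℝ) (hT : ∀ a b, T b a = T a b) (a b : n) :
    4 * T a b
      = (Pi.single a (1 : ℝ) + Pi.single b 1) ⬝ᵥ (T *ᵥ (Pi.single a (1 : ℝ) + Pi.single b 1))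
        - (Pi.single a (1 : ℝ) - Pi.single b 1) ⬝ᵥ (T *ᵥ (Pi.single a (1 : ℝ) - Pi.single b 1)) := by
  simp only [Matrix.mulVec_add, Matrix.mulVec_sub, dotProduct_add, dotProduct_sub, add_dotProduct,
    sub_dotProduct, single_dot_mulVec_single, hT a b]
  ring

/-- Parallelogram identity for the two polarization vectors: `‖e_a+e_b‖² + ‖e_a−e_b‖² = 4`. [folklore] -/
theorem polar_norms (a b : n) :
    (Pi.single a (1 : ℝ) + Pi.single b (1 : ℝ)) ⬝ᵥ (Pi.single a (1 : ℝ) + Pi.single b (1 : ℝ))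
      + (Pi.single a (1 : ℝ) - Pi.single b (1 : ℝ)) ⬝ᵥ (Pi.single a (1 : ℝ) - Pi.single b (1 : ℝ))
      = (4 : ℝ) := by
  have h1 : Pi.single a (1 : ℝ) ⬝ᵥ Pi.single a (1 : ℝ) = 1 := by simp
  have h2 : Pi.single b (1 : ℝ) ⬝ᵥ Pi.single b (1 : ℝ) = 1 := by simp
  simp only [dotProduct_add, dotProduct_sub, add_dotProduct, sub_dotProduct, h1, h2,
    dotProduct_comm (Pi.single b (1 : ℝ)) (Pi.single a 1)]
  ring

end Polarization

namespace Torus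

variable {d : ℕ}

section SymbolToKernel

variable (K : Fin d → ℕ) [hK : ∀ μ, NeZero (K μ)]

/-- **Sup-norm of a kernel difference from the sup-norm of the symbol difference** — the content of "(4.35) ⇒ the
kernel of `Δ^{(k+n)} − Δ^{(k)}` is `O(L^{−2k})` entrywise" (King p.675 "Combining Lemma 4.3 and …"):  if two SYMMETRIC
operators on the torus have plane-wave forms `|Ω|⟨x,T_ix⟩ = Σ_q σ_i(q)|x̃(q)|²` and `|σ₁(q) − σ₀(q)| ≤ ε` for all `q`,
then `|T₁(z,w) − T₀(z,w)| ≤ ε` for all `z, w` (polarization + Parseval; no character bounds needed).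
[cite: King1986, (4.35) p.674, Lemma 4.3 (4.18) p.672, (4.41) p.675] [folklore] -/
theorem abs_sub_apply_le_of_symbols (T₁ T₀ : Matrix (Tor K) (Tor K) ℝ)
    (h₁ : ∀ a b, T₁ b a = T₁ a b) (h₀ : ∀ a b, T₀ b a = T₀ a b) (σ₁ σ₀ : Tor K → ℝ)
    (hf₁ : ∀ x : Tor K → ℝ,
      (Fintype.card (Tor K) : ℝ) * (x ⬝ᵥ (T₁ *ᵥ x)) = ∑ q, σ₁ q * ‖ft K x q‖ ^ 2)
    (hf₀ : ∀ x : Tor K → ℝ,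
      (Fintype.card (Tor K) : ℝ) * (x ⬝ᵥ (T₀ *ᵥ x)) = ∑ q, σ₀ q * ‖ft K x q‖ ^ 2)
    {ε : ℝ} (hε : ∀ q, |σ₁ q - σ₀ q| ≤ ε) (z w : Tor K) : |T₁ z w - T₀ z w| ≤ ε := by
  have hcard : (0 : ℝ) < Fintype.card (Tor K) := by exact_mod_cast Fintype.card_pos
  set D : Matrix (Tor K) (Tor K) ℝ := T₁ - T₀ with hDdef
  have hD : ∀ a b, D b a = D a b := fun a b => by simp only [hDdef, Matrix.sub_apply, h₁ a b, h₀ a b]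
  have hfD : ∀ x : Tor K → ℝ,
      (Fintype.card (Tor K) : ℝ) * (x ⬝ᵥ (D *ᵥ x)) = ∑ q, (σ₁ q - σ₀ q) * ‖ft K x q‖ ^ 2 := by
    intro x
    rw [hDdef, Matrix.sub_mulVec, dotProduct_sub, mul_sub, hf₁, hf₀, ← Finset.sum_sub_distrib]
    exact Finset.sum_congr rfl fun q _ => by ring
  set ep : Tor K → ℝ := Pi.single z (1 : ℝ) + Pi.single w 1 with hep
  set em : Tor K → ℝ := Pi.single z (1 : ℝ) - Pi.single w 1 with hem
  have hpol : 4 * D z w = ep ⬝ᵥ (D *ᵥ ep) - em ⬝ᵥ (D *ᵥ em) := four_mul_apply_eq_polar D hD z w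
  have hmain : (Fintype.card (Tor K) : ℝ) * (4 * D z w)
      = ∑ q, (σ₁ q - σ₀ q) * (‖ft K ep q‖ ^ 2 - ‖ft K em q‖ ^ 2) := by
    rw [hpol, mul_sub, hfD, hfD, ← Finset.sum_sub_distrib]
    exact Finset.sum_congr rfl fun q _ => by ring
  have hbound : |(Fintype.card (Tor K) : ℝ) * (4 * D z w)| ≤ ε * ((Fintype.card (Tor K) : ℝ) * 4) := by
    rw [hmain]
    calc |∑ q, (σ₁ q - σ₀ q) * (‖ft K ep q‖ ^ 2 - ‖ft K em q‖ ^ 2)|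
        ≤ ∑ q, |(σ₁ q - σ₀ q) * (‖ft K ep q‖ ^ 2 - ‖ft K em q‖ ^ 2)| := Finset.abs_sum_le_sum_abs _ _
      _ ≤ ∑ q, ε * (‖ft K ep q‖ ^ 2 + ‖ft K em q‖ ^ 2) := by
          refine Finset.sum_le_sum fun q _ => ?_
          rw [abs_mul]
          refine mul_le_mul (hε q) ?_ (abs_nonneg _) ((abs_nonneg _).trans (hε q))
          have h1 : 0 ≤ ‖ft K ep q‖ ^ 2 := sq_nonneg _
          have h2 : 0 ≤ ‖ft K em q‖ ^ 2 := sq_nonneg _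
          rw [abs_le]
          constructor <;> linarith
      _ = ε * ((Fintype.card (Tor K) : ℝ) * (ep ⬝ᵥ ep) + (Fintype.card (Tor K) : ℝ) * (em ⬝ᵥ em)) := by
          rw [← Finset.mul_sum, Finset.sum_add_distrib, parseval_dot, parseval_dot]
      _ = ε * ((Fintype.card (Tor K) : ℝ) * 4) := by
          rw [← mul_add, polar_norms]
  have hε0 : 0 ≤ ε := (abs_nonneg _).trans (hε 0)
  have h4 : |D z w| * ((Fintype.card (Tor K) : ℝ) * 4) ≤ ε * ((Fintype.card (Tor K) : ℝ) * 4) := by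
    have : |(Fintype.card (Tor K) : ℝ) * (4 * D z w)| = |D z w| * ((Fintype.card (Tor K) : ℝ) * 4) := by
      rw [abs_mul, abs_mul, abs_of_pos hcard, abs_of_pos (by norm_num : (0 : ℝ) < 4)]
      ring
    rw [← this]
    exact hbound
  have hDzw : D z w = T₁ z w - T₀ z w := rfl
  rw [← hDzw]
  exact le_of_mul_le_mul_right h4 (by positivity)

end SymbolToKernel

/-! ## §1b King's symbols: the zero mode and the uniform symbol rate `θ_k·a` -/

section Symbols

variable {dd : ℕ}

/-- A non-zero vector has positive `|p|²`. [folklore] -/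
theorem momSq_pos_of_ne_zero {p : Fin dd → ℝ} (hp : p ≠ 0) : 0 < momSq p := by
  obtain ⟨μ, hμ⟩ := Function.ne_iff.mp hp
  have h1 : 0 < p μ ^ 2 := lt_of_le_of_ne (sq_nonneg _) (Ne.symm (pow_ne_zero 2 hμ))
  exact lt_of_lt_of_le h1 (Finset.single_le_sum (f := fun ν => p ν ^ 2) (fun ν _ => sq_nonneg _)
    (Finset.mem_univ μ))

/-- **The zero mode of King's symbol (4.5)**: `Δ^{(k)}(0) = (a_k⁻¹ + (m²)⁻¹)⁻¹` — at `p′ = 0` only the un-aliased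
term `l = 0` survives (`|u(2πl)|² = 0` for `l ≠ 0`) and `Δ^η(0) = m²`. [cite: King1986, (4.3)–(4.5) p.670] -/
theorem DeltaEff_zero (a : ℝ) (N : ℕ) [NeZero N] (M : ℝ) :
    DeltaEff a N M (0 : Fin dd → ℝ) = (a⁻¹ + M⁻¹)⁻¹ := by
  unfold DeltaEff composedInvResc
  congr 1
  congr 1
  rw [Finset.sum_eq_single (fun _ => (0 : Fin N))]
  · -- the un-aliased term
    have hU : B4Strip.Ur N (fun _ => (0 : Fin N)) (0 : Fin dd → ℝ) = 1 := by
      unfold B4Strip.Ur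
      refine Finset.prod_eq_one fun μ _ => ?_
      simp [B4Strip.uFactorr]
    have hD : B4Strip.DeltaXir N M (B4Strip.shiftr N (fun _ => (0 : Fin N)) (0 : Fin dd → ℝ)) = M := by
      rw [shiftr_zero]
      unfold B4Strip.DeltaXir
      have h0 : B4Strip.Sxir N 0 = 0 := by simp [B4Strip.Sxir]
      simp [h0]
    rw [hU, hD, one_mul]
  · -- aliased terms vanish at p′ = 0
    intro m _ hm
    have hμ : ∃ μ, m μ ≠ 0 := by
      by_contra h
      push Not at h
      exact hm (funext h)
    obtain ⟨μ, hμ⟩ := hμ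
    have hk : ((m μ : ℕ) : ℕ) ≠ 0 := fun h => hμ (Fin.ext h)
    have hU : B4Strip.Ur N m (0 : Fin dd → ℝ) = 0 := by
      unfold B4Strip.Ur
      refine Finset.prod_eq_zero (Finset.mem_univ μ) ?_
      rw [B4Strip.uFactorr, if_neg hk]
      simp [B4Strip.S1r]
    rw [hU, zero_mul]
  · intro h; exact absurd (Finset.mem_univ _) h

/-- **Lemma 4.3 at every coarse momentum, incl. the zero mode, with the uniform constant `θ_k·a`**: for `L ≥ 2`,
`k, n ≥ 1`, `a > 0`, `m² > 0` and `p′ ∈ [−π,π]^d` (ANY, also `p′ = 0`),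
`|Δ^{(k)}(p′) − Δ^{(k+n)}(p′)| ≤ θ_k·a`, `θ_k = thetaK a L k n = 2a_k(a_n⁻¹ + π²/48 + 1/3)L^{−2k}`: for `p′ ≠ 0`
this is `lemma43_aK` × `Δ^{(k)} ≤ a_k ≤ a`; at `p′ = 0` the two symbols are `(a_k⁻¹ + m⁻²)⁻¹`, `(a_{k+n}⁻¹ + m⁻²)⁻¹`
with `a_{k+n}⁻¹ = a_k⁻¹ + L^{−2k}a_n⁻¹` (`inv_aK_add`). [cite: King1986, Lemma 4.3 (4.18) p.672, (2.13) p.653] -/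
theorem abs_DeltaEff_sub_le_thetaK {a : ℝ} (ha : 0 < a) {L k n : ℕ} (hL : 2 ≤ L) (hk : 1 ≤ k) (hn : 1 ≤ n)
    {m2 : ℝ} (hm : 0 < m2) {p : Fin dd → ℝ} (hp : ∀ μ, |p μ| ≤ π) :
    |DeltaEff (aK a L k) (L ^ k) m2 p - DeltaEff (aK a L (k + n)) (L ^ n * L ^ k) m2 p|
      ≤ thetaK a L k n * a := by
  have hL1 : (1 : ℝ) < L := by exact_mod_cast hL
  have hL0 : L ≠ 0 := by omega
  haveI : NeZero L := ⟨hL0⟩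
  have hak : 0 < aK a L k := aK_pos ha hL1 hk
  have han : 0 < aK a L n := aK_pos ha hL1 hn
  have hakle : aK a L k ≤ a := aK_le ha hL1 hk
  have hθ0 : 0 ≤ thetaK a L k n := by unfold thetaK; positivity
  by_cases hp0 : p = 0
  · -- the zero mode
    subst hp0
    rw [DeltaEff_zero, DeltaEff_zero]
    set u : ℝ := (aK a L k)⁻¹ with hu
    set δ : ℝ := ((L : ℝ) ^ (2 * k))⁻¹ * (aK a L n)⁻¹ with hδ
    have hu0 : 0 < u := inv_pos.mpr hak
    have hδ0 : 0 ≤ δ := by positivity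
    have hm0 : 0 < m2⁻¹ := inv_pos.mpr hm
    have hrel : (aK a L (k + n))⁻¹ = u + δ := inv_aK_add ha hL1 k n
    rw [hrel]
    have hX : 0 < u + m2⁻¹ := by positivity
    have hY : 0 < u + δ + m2⁻¹ := by positivity
    have hdiff : (u + m2⁻¹)⁻¹ - (u + δ + m2⁻¹)⁻¹ = δ / ((u + m2⁻¹) * (u + δ + m2⁻¹)) := by
      field_simp
      ring
    have hnn : 0 ≤ (u + m2⁻¹)⁻¹ - (u + δ + m2⁻¹)⁻¹ := by rw [hdiff]; positivity
    rw [abs_of_nonneg hnn, hdiff]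
    -- δ/((u+m⁻²)(u+δ+m⁻²)) ≤ δ/u² = δ a_k² ≤ θ_k a
    have h1 : δ / ((u + m2⁻¹) * (u + δ + m2⁻¹)) ≤ δ / (u * u) := by
      apply div_le_div_of_nonneg_left hδ0 (by positivity)
      exact mul_le_mul (by linarith) (by linarith) hu0.le hX.le
    have h2 : δ / (u * u) = δ * aK a L k ^ 2 := by
      rw [hu]; field_simp
    have h3 : δ * aK a L k ^ 2 ≤ thetaK a L k n * a := by
      have e : thetaK a L k n
          = aK a L k * (2 * (((aK a L n)⁻¹ + π ^ 2 / 48 + 1 / 3) * (((L : ℝ) ^ (2 * k)))⁻¹)) := by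
        unfold thetaK
        push_cast
        rw [← pow_mul, mul_comm k 2]
      rw [e, hδ]
      set Linv : ℝ := (((L : ℝ) ^ (2 * k)))⁻¹ with hLinv
      have hLinv0 : 0 ≤ Linv := by positivity
      have hinvn : 0 ≤ (aK a L n)⁻¹ := (inv_pos.mpr han).le
      have hc : 0 ≤ π ^ 2 / 48 + 1 / 3 := by positivity
      have hZ : 0 ≤ aK a L k * a := by positivity
      have step1 : Linv * (aK a L n)⁻¹ * aK a L k ^ 2 ≤ Linv * (aK a L n)⁻¹ * (aK a L k * a) :=
        mul_le_mul_of_nonneg_left (by nlinarith [hak, hakle]) (by positivity)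
      have hXY : Linv * (aK a L n)⁻¹ ≤ Linv * ((aK a L n)⁻¹ + π ^ 2 / 48 + 1 / 3) :=
        mul_le_mul_of_nonneg_left (by linarith) hLinv0
      have hY : 0 ≤ Linv * ((aK a L n)⁻¹ + π ^ 2 / 48 + 1 / 3) := by positivity
      have step2 : Linv * (aK a L n)⁻¹ * (aK a L k * a)
          ≤ Linv * ((aK a L n)⁻¹ + π ^ 2 / 48 + 1 / 3) * (aK a L k * a) * 2 := by
        have h6 := mul_le_mul_of_nonneg_right hXY hZ
        have h7 := mul_nonneg hY hZ
        linarith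
      calc Linv * (aK a L n)⁻¹ * aK a L k ^ 2 ≤ Linv * (aK a L n)⁻¹ * (aK a L k * a) := step1
        _ ≤ Linv * ((aK a L n)⁻¹ + π ^ 2 / 48 + 1 / 3) * (aK a L k * a) * 2 := step2
        _ = aK a L k * (2 * (((aK a L n)⁻¹ + π ^ 2 / 48 + 1 / 3) * Linv)) * a := by ring
    calc δ / ((u + m2⁻¹) * (u + δ + m2⁻¹)) ≤ δ / (u * u) := h1
      _ = δ * aK a L k ^ 2 := h2
      _ ≤ thetaK a L k n * a := h3
  · -- p′ ≠ 0: Lemma 4.3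
    have hmom : 0 < momSq p := momSq_pos_of_ne_zero hp0
    have h43 := lemma43_aK (dd := dd) ha hL hk hn hm.le hp hmom
    have hle : DeltaEff (aK a L k) (L ^ k) m2 p ≤ a := (DeltaEff_le hak (L ^ k) hm.le p).trans hakle
    have hpos : 0 ≤ DeltaEff (aK a L k) (L ^ k) m2 p :=
      (DeltaEff_pos hak (Nat.one_le_pow k L (by omega)) hm.le hp hmom).le
    have e : aK a L k * (2 * (((aK a L n)⁻¹ + π ^ 2 / 48 + 1 / 3) * ((((L ^ k : ℕ) : ℝ)) ^ 2)⁻¹))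
        = thetaK a L k n := rfl
    rw [e] at h43
    exact h43.trans (mul_le_mul_of_nonneg_left hle hθ0)

end Symbols

/-! ## §1c The kernel sup-rate of King's effective Laplacians -/

section KernelRate

variable (N : ℕ) [NeZero N] (M : Fin d → ℕ) [hM : ∀ μ, NeZero (M μ)]

/-- `Δ_eff` is symmetric (`A₀` is, and `(QA₀⁻¹Qᵀ)ᵀ = Q(A₀ᵀ)⁻¹Qᵀ`). [folklore] -/
theorem effLaplacian_symm (a c m2 : ℝ) (x y : Tor M) :
    effLaplacian N M a c m2 y x = effLaplacian N M a c m2 x y := by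
  have hT : (Qmat N M * (fineOp N M a c m2)⁻¹ * (Qmat N M)ᵀ)ᵀ
      = Qmat N M * (fineOp N M a c m2)⁻¹ * (Qmat N M)ᵀ := by
    rw [Matrix.transpose_mul, Matrix.transpose_mul, Matrix.transpose_transpose, Matrix.transpose_nonsing_inv,
      fineOp_transpose, Matrix.mul_assoc]
  have h1 := congrFun (congrFun hT x) y
  rw [Matrix.transpose_apply] at h1
  have h2 : (1 : Matrix (Tor M) (Tor M) ℝ) y x = (1 : Matrix (Tor M) (Tor M) ℝ) x y := by
    by_cases h : x = y
    · rw [h]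
    · rw [Matrix.one_apply_ne h, Matrix.one_apply_ne (Ne.symm h)]
  simp only [effLaplacian, Matrix.sub_apply, Matrix.smul_apply, h1, h2]

variable {N M}

/-- **THE KERNEL RATE INPUT OF LEMMA 4.5, PROVED**: on every torus `Ω = Π ℤ/(L·M_μ)`, for `L ≥ 2`, `k, n ≥ 1`, `a > 0`,
`m² > 0`, the kernels of King's actual effective Laplacians satisfy
`|Δ^{(k+n)}(z,w) − Δ^{(k)}(z,w)| ≤ θ_k·a = 2a·a_k(a_n⁻¹ + π²/48 + 1/3)·L^{−2k}` for ALL `z, w` — King: *"Combining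
Lemma 4.3 and the uniform exponential decay of Δ^{(k)} … gives |(4.40)| ≤ CL^{−k} …"*; this is the Lemma-4.3 half
(sup-norm `O(L^{−2k})`), obtained from the symbol rate through the plane-wave form (4.35) (`effLaplacian_form_DeltaEff`)
and polarization. [cite: King1986, Lemma 4.3 (4.18) p.672, (4.35) p.674, (4.41) p.675] -/
theorem effLaplacian_sub_apply_le {a m2 : ℝ} (ha : 0 < a) (hm : 0 < m2) {L k n : ℕ} [NeZero L] (hL : 2 ≤ L)
    (hk : 1 ≤ k) (hn : 1 ≤ n) (M : Fin d → ℕ) [∀ μ, NeZero (M μ)] (z w : Tor (fine L M)) :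
    |effLaplacian (L ^ n * L ^ k) (fine L M) (aK a L (k + n)) (((L ^ n * L ^ k : ℕ) : ℝ) ^ 2) m2 z w
        - effLaplacian (L ^ k) (fine L M) (aK a L k) (((L ^ k : ℕ) : ℝ) ^ 2) m2 z w|
      ≤ thetaK a L k n * a := by
  have hL1 : (1 : ℝ) < L := by exact_mod_cast hL
  have hN₁ : 1 ≤ L ^ k := Nat.one_le_pow k L (by omega)
  have hN₀ : 1 ≤ L ^ n * L ^ k := Nat.one_le_iff_ne_zero.mpr (NeZero.ne _)
  have ha₁ : 0 < aK a L k := aK_pos ha hL1 hk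
  have ha₀ : 0 < aK a L (k + n) := aK_pos ha hL1 (by omega)
  rw [abs_sub_comm]
  exact abs_sub_apply_le_of_symbols (fine L M) _ _
    (effLaplacian_symm (L ^ k) (fine L M) _ _ _) (effLaplacian_symm (L ^ n * L ^ k) (fine L M) _ _ _)
    (fun q => DeltaEff (aK a L k) (L ^ k) m2 (sOf (fine L M) q))
    (fun q => DeltaEff (aK a L (k + n)) (L ^ n * L ^ k) m2 (sOf (fine L M) q))
    (effLaplacian_form_DeltaEff (L ^ k) (fine L M) hN₁ ha₁ hm)
    (effLaplacian_form_DeltaEff (L ^ n * L ^ k) (fine L M) hN₀ ha₀ hm)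
    (fun q => abs_DeltaEff_sub_le_thetaK ha hL hk hn hm (fun μ => abs_sOf_le (fine L M) q μ)) z w

end KernelRate

/-! ## §2 Uniform constants over `a_k ∈ [a(1 − L⁻²), a]` and the decay inputs (4.34) for `Δ^{(k)}`, `Δ^{(k+n)}`, `aL⁻²Q*Q` -/

section Constants

open QGQInverse B4Sect5Torus

/-- `γ_A` is monotone in `a`. [folklore] -/
theorem gamA_mono {a a' : ℝ} (h : a ≤ a') (dd : ℕ) : gamA a dd ≤ gamA a' dd := by
  unfold gamA
  have hc : 0 ≤ (4 / π ^ 2 : ℝ) ^ dd := by positivity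
  exact min_le_min le_rfl (by
    have := mul_le_mul_of_nonneg_right h hc
    linarith)

/-- King's lower bound `a(1 − L⁻²) ≤ a_k` ((2.13): `a_k = a(1 − L⁻²)(1 − L^{−2k})⁻¹`), as the uniform `a_min`. [cite: King1986, (2.13) p.653] -/
def aminL (a : ℝ) (L : ℕ) : ℝ := a * (1 - ((L : ℝ) ^ 2)⁻¹)

/-- `a_min > 0` for `L ≥ 2`, `a > 0`. [folklore] -/
theorem aminL_pos {a : ℝ} (ha : 0 < a) {L : ℕ} (hL : 2 ≤ L) : 0 < aminL a L := by
  unfold aminL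
  have hL2 : (4 : ℝ) ≤ (L : ℝ) ^ 2 := by
    have : (2 : ℝ) ≤ L := by exact_mod_cast hL
    nlinarith
  have : ((L : ℝ) ^ 2)⁻¹ ≤ 1 / 4 := by
    rw [one_div]; exact inv_anti₀ (by norm_num) hL2
  nlinarith

/-- `a_min ≤ a_k ≤ a`. [cite: King1986, (2.13) p.653] -/
theorem aminL_le_aK {a : ℝ} (ha : 0 < a) {L : ℕ} (hL : 2 ≤ L) {k : ℕ} (hk : 1 ≤ k) :
    aminL a L ≤ aK a L k ∧ aK a L k ≤ a := by
  have hL1 : (1 : ℝ) < L := by exact_mod_cast hL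
  exact ⟨aK_ge ha hL1 hk, aK_le ha hL1 hk⟩

/-- `a_min ≤ a`. [folklore] -/
theorem aminL_le {a : ℝ} (ha : 0 < a) (L : ℕ) : aminL a L ≤ a := by
  unfold aminL
  have : 0 ≤ ((L : ℝ) ^ 2)⁻¹ := by positivity
  nlinarith

variable (d)

/-- The UNIFORM decay rate of the effective Laplacians over `a₁ ∈ [a_min, a]`:
`κ_U = min(1, √(γ_A(a_min)/(2(2d + a))))`. [folklore] -/
def kapU (a amin : ℝ) : ℝ := min 1 (Real.sqrt (gamA amin d / (2 * (2 * d + a))))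

/-- The UNIFORM decay constant `C_U = a + a²(2/γ_A(a_min))e²`. [folklore] -/
def CDelU (a amin : ℝ) : ℝ := a + a ^ 2 * (2 / gamA amin d) * Real.exp 2

variable {d}

/-- `0 < κ_U ≤ 1`. [folklore] -/
theorem kapU_pos_le {a amin : ℝ} (ha : 0 < a) (hamin : 0 < amin) : 0 < kapU d a amin ∧ kapU d a amin ≤ 1 := by
  unfold kapU
  refine ⟨lt_min one_pos (Real.sqrt_pos.mpr ?_), min_le_left _ _⟩
  have := gamA_pos hamin d
  positivity

/-- `(2d + a)κ_U² ≤ γ_A(a_min)/2`. [folklore] -/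
theorem rho_kapU_le {a amin : ℝ} (ha : 0 < a) (hamin : 0 < amin) :
    (2 * d + a) * kapU d a amin ^ 2 ≤ gamA amin d / 2 := by
  have hγ := gamA_pos hamin d
  have h1 : kapU d a amin ^ 2 ≤ gamA amin d / (2 * (2 * d + a)) := by
    have hk0 : 0 ≤ kapU d a amin := (kapU_pos_le ha hamin).1.le
    calc kapU d a amin ^ 2 ≤ Real.sqrt (gamA amin d / (2 * (2 * d + a))) ^ 2 :=
          pow_le_pow_left₀ hk0 (min_le_right _ _) 2
      _ = gamA amin d / (2 * (2 * d + a)) := Real.sq_sqrt (by positivity)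
  calc (2 * d + a) * kapU d a amin ^ 2 ≤ (2 * d + a) * (gamA amin d / (2 * (2 * d + a))) :=
        mul_le_mul_of_nonneg_left h1 (by positivity)
    _ = gamA amin d / 2 := by field_simp

/-- `0 < C_U`. [folklore] -/
theorem CDelU_pos {a amin : ℝ} (ha : 0 < a) (hamin : 0 < amin) : 0 < CDelU d a amin := by
  unfold CDelU; have := gamA_pos hamin d; positivity

/-- **Uniform decay of `Δ^{(k)}` over the whole run**: for `a_min ≤ a₁ ≤ a`, `m² > 0`, every `N ≥ 1` and every torus,
`|Δ_{a₁,N}(b,b′)| ≤ C_U e^{−κ_U tdist(b,b′)}` — `UniformDecay.effLaplacian_entry_le` at the common rate `κ_U` with the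
constants majorised monotonically in `a₁`. [cite: King1986, (4.34) p.674; Dimock2013, App. D Lemmas 29–30] -/
theorem effLaplacian_entry_le_unif {a amin a₁ m2 : ℝ} (ha : 0 < a) (hamin : 0 < amin) (h₁ : amin ≤ a₁)
    (h₂ : a₁ ≤ a) (hm : 0 < m2) (N : ℕ) [NeZero N] (M : Fin d → ℕ) [∀ μ, NeZero (M μ)] (b b' : Tor M) :
    |effLaplacian N M a₁ ((N : ℝ) ^ 2) m2 b b'| ≤ CDelU d a amin * Real.exp (-(kapU d a amin * tdistT M b b')) := by
  have ha₁ : 0 < a₁ := lt_of_lt_of_le hamin h₁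
  obtain ⟨hk0, hk1⟩ := kapU_pos_le (d := d) ha hamin
  have hγmono : gamA amin d ≤ gamA a₁ d := gamA_mono h₁ d
  have hγ := gamA_pos hamin d
  have hρ' : (2 * d + a₁) * kapU d a amin ^ 2 ≤ gamA amin d / 2 := by
    calc (2 * d + a₁) * kapU d a amin ^ 2 ≤ (2 * d + a) * kapU d a amin ^ 2 :=
          mul_le_mul_of_nonneg_right (by linarith) (sq_nonneg _)
      _ ≤ gamA amin d / 2 := rho_kapU_le ha hamin
  have hρ : (2 * d + a₁) * kapU d a amin ^ 2 < gamA a₁ d := by linarith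
  have h := effLaplacian_entry_le N M ha₁ hm hk0.le hk1 hρ b b'
  refine h.trans (mul_le_mul_of_nonneg_right ?_ (Real.exp_pos _).le)
  unfold CDelU
  have hgap : gamA amin d / 2 ≤ gamA a₁ d - (2 * d + a₁) * kapU d a amin ^ 2 := by linarith
  have h3 : (gamA a₁ d - (2 * d + a₁) * kapU d a amin ^ 2)⁻¹ ≤ 2 / gamA amin d := by
    rw [div_eq_mul_inv, show (2 : ℝ) * (gamA amin d)⁻¹ = (gamA amin d / 2)⁻¹ by rw [inv_div]; ring]
    exact inv_anti₀ (by positivity) hgap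
  have h4 : Real.exp (2 * kapU d a amin) ≤ Real.exp 2 := Real.exp_le_exp.mpr (by linarith)
  have h5 : 0 ≤ (gamA a₁ d - (2 * d + a₁) * kapU d a amin ^ 2)⁻¹ := inv_nonneg.mpr (by linarith)
  have h6 : a₁ ^ 2 ≤ a ^ 2 := pow_le_pow_left₀ ha₁.le h₂ 2
  calc a₁ + a₁ ^ 2 * (gamA a₁ d - (2 * d + a₁) * kapU d a amin ^ 2)⁻¹ * Real.exp (2 * kapU d a amin)
      ≤ a + a ^ 2 * (2 / gamA amin d) * Real.exp 2 := by
        gcongr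
    _ = _ := rfl

/-- **The short-range term `B = aL⁻²Q*Q` in (4.34)-form**: `|B(x,y)| ≤ aL^{−2−d}e^{κ(L−1)}·e^{−κ tdist(x,y)}` (`Q*Q`
vanishes across blocks; within a block `tdist ≤ L − 1`). [cite: King1986, p.674 ("Q*Q is a short-range operator")] -/
theorem blockTerm_entry_le (L : ℕ) [NeZero L] (M : Fin d → ℕ) [∀ μ, NeZero (M μ)] {a κ : ℝ} (ha : 0 ≤ a)
    (hκ : 0 ≤ κ) (x y : Tor (fine L M)) :
    |((a * ((L : ℝ) ^ 2)⁻¹) • blockProj L M) x y|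
      ≤ (a * ((L : ℝ) ^ 2)⁻¹ * ((L : ℝ) ^ d)⁻¹ * Real.exp (κ * ((L : ℝ) - 1)))
        * Real.exp (-(κ * tdistT (fine L M) x y)) := by
  rw [Matrix.smul_apply, smul_eq_mul]
  by_cases h : blockOf L M x = blockOf L M y
  · have hbp : blockProj L M x y = ((L : ℝ) ^ d)⁻¹ := by unfold blockProj; rw [if_pos h]
    rw [hbp, abs_of_nonneg (by positivity), mul_assoc (a * ((L : ℝ) ^ 2)⁻¹ * ((L : ℝ) ^ d)⁻¹), ← Real.exp_add]
    have ht : tdistT (fine L M) x y ≤ (L : ℝ) - 1 := tdistT_le_of_blockOf_eq L M h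
    have h1 : (1 : ℝ) ≤ Real.exp (κ * ((L : ℝ) - 1) + -(κ * tdistT (fine L M) x y)) :=
      Real.one_le_exp (by nlinarith)
    calc a * ((L : ℝ) ^ 2)⁻¹ * ((L : ℝ) ^ d)⁻¹ = a * ((L : ℝ) ^ 2)⁻¹ * ((L : ℝ) ^ d)⁻¹ * 1 := (mul_one _).symm
      _ ≤ _ := mul_le_mul_of_nonneg_left h1 (by positivity)
  · have hbp : blockProj L M x y = 0 := by unfold blockProj; rw [if_neg h]
    rw [hbp, mul_zero, abs_zero]
    positivity

end Constants

/-! ## §3 KING'S LEMMA 4.5 ON THE TORUS — hypothesis-free, constants explicit -/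

section Assembly

open QGQInverse B4Sect5Torus

variable (d)

/-- The endpoint coercivity constant `γ₀ = γ₀^F(L, a_min, a)` of `king433`. [cite: King1986, (4.33) p.674] -/
def gam0L (a : ℝ) (L : ℕ) : ℝ := gamma0F L (aminL a L) a d

/-- The short-range constant of `aL⁻²Q*Q`: `c_B = aL^{−2−d}e^{κ_U(L−1)}`. [folklore] -/
def cB (a : ℝ) (L : ℕ) : ℝ :=
  a * ((L : ℝ) ^ 2)⁻¹ * ((L : ℝ) ^ d)⁻¹ * Real.exp (kapU d a (aminL a L) * ((L : ℝ) - 1))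

/-- The Combes–Thomas rate `κ′ = rate(K_d, γ₀, C_U + c_B, κ_U)` of `B4Sect5Torus` (≤ κ_U/4, and `κ′·M₀ ≤ γ₀/2`).
[folklore] -/
def kapCT (a : ℝ) (L : ℕ) : ℝ :=
  B4Sect5Torus.rate (B4Sect5Proof.latticeConst d) (gam0L d a L) (CDelU d a (aminL a L) + cB d a L)
    (kapU d a (aminL a L))

/-- The volume-independent lattice sum `V = K_d(κ′/2)`. [folklore] -/
def V45 (a : ℝ) (L : ℕ) : ℝ := B4Sect5Proof.latticeConst d (kapCT d a L / 2)

/-- The uniform Lemma-4.3 constant `θ̄ = 2a(a_min⁻¹ + π²/48 + 1/3)`, so that `θ_k ≤ θ̄·L^{−2k}`. [cite: King1986, Lemma 4.3 p.672] -/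
def thetaBar (a : ℝ) (L : ℕ) : ℝ := a * (2 * ((aminL a L)⁻¹ + π ^ 2 / 48 + 1 / 3))

/-- **The constant `C` of (4.38)**: `K₄₅ = √(2 θ̄ a C_U) · (2/γ₀)² · V²`. [folklore] -/
def K45 (a : ℝ) (L : ℕ) : ℝ :=
  Real.sqrt (thetaBar a L * a * (2 * CDelU d a (aminL a L))) * (2 / gam0L d a L) ^ 2 * V45 d a L ^ 2

/-- **The rate `δ₀` of (4.38)**: `δ₄₅ = κ′/2`. [folklore] -/
def delta45 (a : ℝ) (L : ℕ) : ℝ := kapCT d a L / 2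

variable {d}

/-- The lattice-sum profile is nonnegative on positive rates. [folklore] -/
theorem latticeConst_profile_nonneg (dd : ℕ) : ∀ t : ℝ, 0 < t → 0 ≤ B4Sect5Proof.latticeConst dd t :=
  fun _ ht => B4Sect5Proof.latticeConst_nonneg dd ht.le

/-- `γ₀ > 0`. [folklore] -/
theorem gam0L_pos {a : ℝ} (ha : 0 < a) {L : ℕ} (hL : 2 ≤ L) : 0 < gam0L d a L :=
  gamma0F_pos (by omega) (aminL_pos ha hL) ha d

/-- `c_B ≥ 0`. [folklore] -/
theorem cB_nonneg {a : ℝ} (ha : 0 ≤ a) (L : ℕ) : 0 ≤ cB d a L := by unfold cB; positivity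

/-- `0 < κ′ ≤ κ_U/4`. [folklore] -/
theorem kapCT_pos_le {a : ℝ} (ha : 0 < a) {L : ℕ} (hL : 2 ≤ L) :
    0 < kapCT d a L ∧ kapCT d a L ≤ kapU d a (aminL a L) / 4 := by
  have hamin := aminL_pos ha hL
  unfold kapCT
  exact ⟨rate_pos (latticeConst_profile_nonneg d) (gam0L_pos ha hL)
      (add_nonneg (CDelU_pos ha hamin).le (cB_nonneg ha.le L)) (kapU_pos_le ha hamin).1,
    rate_le_quarter _ _ _⟩

/-- `θ_k ≤ θ̄·L^{−2k}`. [cite: King1986, Lemma 4.3 (4.18) p.672] -/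
theorem thetaK_le {a : ℝ} (ha : 0 < a) {L k n : ℕ} (hL : 2 ≤ L) (hk : 1 ≤ k) (hn : 1 ≤ n) :
    thetaK a L k n ≤ thetaBar a L * (((L : ℝ) ^ k) ^ 2)⁻¹ := by
  have hamin := aminL_pos ha hL
  obtain ⟨hk1, hk2⟩ := aminL_le_aK ha hL hk
  obtain ⟨hn1, hn2⟩ := aminL_le_aK ha hL hn
  have hakpos : 0 < aK a L k := lt_of_lt_of_le hamin hk1
  have hinv : (aK a L n)⁻¹ ≤ (aminL a L)⁻¹ := inv_anti₀ hamin hn1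
  unfold thetaK thetaBar
  push_cast
  have hL0 : 0 ≤ (((L : ℝ) ^ k) ^ 2)⁻¹ := by positivity
  have hc : 0 ≤ (aK a L n)⁻¹ + π ^ 2 / 48 + 1 / 3 := by
    have := (inv_pos.mpr (lt_of_lt_of_le hamin hn1)).le; positivity
  calc aK a L k * (2 * (((aK a L n)⁻¹ + π ^ 2 / 48 + 1 / 3) * (((L : ℝ) ^ k) ^ 2)⁻¹))
      ≤ a * (2 * (((aminL a L)⁻¹ + π ^ 2 / 48 + 1 / 3) * (((L : ℝ) ^ k) ^ 2)⁻¹)) := by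
        gcongr
    _ = a * (2 * ((aminL a L)⁻¹ + π ^ 2 / 48 + 1 / 3)) * (((L : ℝ) ^ k) ^ 2)⁻¹ := by ring

/-- **KING'S LEMMA 4.5 (4.38) ON EVERY TORUS, FOR KING'S ACTUAL OPERATORS, NO HYPOTHESIS LEFT.**  Let `L ≥ 2`,
`k, n ≥ 1`, `a > 0`, `m² > 0`, `Ω = Π_μ ℤ/(L·M_μ)` any torus (unit lattice of the `L`-blocks of the next step),
`Δ^{(k)} = a_k − a_k²N₁^dQ(N₁²(−Δ)+m²+a_kQᵀQ)⁻¹Qᵀ` (`N₁ = L^k`, `a_k = aK a L k`) and `Δ^{(k+n)}` (`N₀ = L^{k+n}`,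
`a_{k+n}`) King's effective Laplacians of (2.14)/(4.5), and `C^{(k)} = (Δ^{(k)} + aL⁻²Q*Q)⁻¹`, `C^{(k+n)} =
(Δ^{(k+n)} + aL⁻²Q*Q)⁻¹` the unit-lattice fluctuation covariances (2.16)/(4.32).  Then for all `x, y ∈ Ω`
`|C^{(k)}(x,y) − C^{(k+n)}(x,y)| ≤ K₄₅(a,L,d)·L^{−k}·e^{−δ₄₅(a,L,d)·tdist(x,y)}`
with `K₄₅`, `δ₄₅ > 0` depending on `a`, `L`, `d` ONLY — not on `k`, `n`, `m²` or the torus.  ASSEMBLY of the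
kernel-proved pieces of King's §4 A = 0 chain: (a) (4.33) `king433` (EffectiveLaplacianSymbol); (b) (4.34) for
`Δ^{(k)}`, `Δ^{(k+n)}` = `UniformDecay.effLaplacian_entry_le` (Dimock's Lemmas 29–30) and for `aL⁻²Q*Q`
(`blockTerm_entry_le`), turned into Combes–Thomas-summable weighted sums by `B4Sect5Torus.weightedRowSum_le`; (c) the
rate: Lemma 4.3 for the symbols (`lemma43_aK`) incl. the zero mode, transported to the kernels (§1); (d) lattice sums
`B4Sect5Torus.torusSum_le`; all fed into `CovarianceRate.lemma45_of_supRate` (resolvent identity (4.39)–(4.41)).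
SCOPE: A = 0, periodic boundary conditions, flat blocks, `m² > 0` (King's §4 setting); the rate `δ₄₅ ~ L⁻²·const`
and `K₄₅` are explicit but not optimised; King's free-b.c./reflection transport and everything with `A ≠ 0` are
outside. [cite: King1986, Lemma 4.5 (4.38) p.674, proof (4.39)–(4.41) pp.674–675, (4.32)–(4.34), (2.13)–(2.16) p.653] -/
theorem king_lemma45_torus {a m2 : ℝ} (ha : 0 < a) (hm : 0 < m2) {L k n : ℕ} [NeZero L] (hL : 2 ≤ L)
    (hk : 1 ≤ k) (hn : 1 ≤ n) (M : Fin d → ℕ) [∀ μ, NeZero (M μ)] (x y : Tor (fine L M)) :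
    |(effLaplacian (L ^ k) (fine L M) (aK a L k) (((L ^ k : ℕ) : ℝ) ^ 2) m2
          + (a * ((L : ℝ) ^ 2)⁻¹) • blockProj L M)⁻¹ x y
      - (effLaplacian (L ^ n * L ^ k) (fine L M) (aK a L (k + n)) (((L ^ n * L ^ k : ℕ) : ℝ) ^ 2) m2
          + (a * ((L : ℝ) ^ 2)⁻¹) • blockProj L M)⁻¹ x y|
      ≤ K45 d a L * ((L : ℝ) ^ k)⁻¹ * Real.exp (-(delta45 d a L * tdistT (fine L M) x y)) := by
  -- notation
  set Δ₁ := effLaplacian (L ^ k) (fine L M) (aK a L k) (((L ^ k : ℕ) : ℝ) ^ 2) m2 with hΔ₁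
  set Δ₀ := effLaplacian (L ^ n * L ^ k) (fine L M) (aK a L (k + n)) (((L ^ n * L ^ k : ℕ) : ℝ) ^ 2) m2
    with hΔ₀
  set B : Matrix (Tor (fine L M)) (Tor (fine L M)) ℝ := (a * ((L : ℝ) ^ 2)⁻¹) • blockProj L M with hB
  set ρd := tdistT (fine L M) with hρd
  set amin := aminL a L with hamin_def
  set γ₀ := gam0L d a L with hγ₀
  set κU := kapU d a amin with hκU
  set CU := CDelU d a amin with hCU
  set cb := cB d a L with hcb
  set κ' := kapCT d a L with hκ'
  set Kd := B4Sect5Proof.latticeConst d with hKd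
  -- positivity of the data
  have hL1 : 1 ≤ L := by omega
  have hLr : (1 : ℝ) < L := by exact_mod_cast hL
  have hamin : 0 < amin := aminL_pos ha hL
  obtain ⟨hak1, hak2⟩ := aminL_le_aK ha hL hk
  obtain ⟨hakn1, hakn2⟩ := aminL_le_aK ha hL (show 1 ≤ k + n by omega)
  have hγ₀pos : 0 < γ₀ := gam0L_pos ha hL
  obtain ⟨hκU0, hκU1⟩ := kapU_pos_le (d := d) ha hamin
  have hCU0 : 0 < CU := CDelU_pos ha hamin
  have hcb0 : 0 ≤ cb := cB_nonneg ha.le L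
  obtain ⟨hκ'0, hκ'le⟩ := kapCT_pos_le (d := d) ha hL
  have hκ'U : κ' ≤ κU / 4 := hκ'le
  have hKd : ∀ t : ℝ, 0 < t → 0 ≤ Kd t := latticeConst_profile_nonneg d
  -- (a) endpoint coercivity (4.33): king433
  have h433 := king433 L M hL1 hamin ha hak1 hakn1 (L ^ k) (L ^ n * L ^ k) hm hm
  have h1 : Coercive (Δ₁ + B) γ₀ := h433.1
  have h0 : Coercive (Δ₀ + B) γ₀ := h433.2
  -- (b) pointwise decay (4.34)
  have hD1 : ∀ z w, |Δ₁ z w| ≤ CU * Real.exp (-(κU * ρd z w)) := fun z w =>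
    effLaplacian_entry_le_unif ha hamin hak1 hak2 hm (L ^ k) (fine L M) z w
  have hD0 : ∀ z w, |Δ₀ z w| ≤ CU * Real.exp (-(κU * ρd z w)) := fun z w =>
    effLaplacian_entry_le_unif ha hamin hakn1 hakn2 hm (L ^ n * L ^ k) (fine L M) z w
  have hDB : ∀ z w, |B z w| ≤ cb * Real.exp (-(κU * ρd z w)) := fun z w =>
    blockTerm_entry_le L M ha.le hκU0.le z w
  -- pseudo-distance and lattice sums
  have hpd : IsPseudoDist ρd := tdistT_isPseudoDist (fine L M)
  have hSB : SumBound ρd Kd := tdistT_sumBound (fine L M)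
  -- weighted sums (Combes–Thomas inputs)
  have hr1 : ∀ i, wRow Δ₁ ρd κ' i ≤ κ' * weightC Kd CU κU := fun i =>
    weightedRowSum_le hpd.nonneg hSB Δ₁ hCU0.le hκU0 hκ'0.le hκ'U hD1 i
  have hr0 : ∀ i, wRow Δ₀ ρd κ' i ≤ κ' * weightC Kd CU κU := fun i =>
    weightedRowSum_le hpd.nonneg hSB Δ₀ hCU0.le hκU0 hκ'0.le hκ'U hD0 i
  have hrB : ∀ i, wRow B ρd κ' i ≤ κ' * weightC Kd cb κU := fun i =>
    weightedRowSum_le hpd.nonneg hSB B hcb0 hκU0 hκ'0.le hκ'U hDB i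
  have hc1 : ∀ j, wCol Δ₁ ρd κ' j ≤ κ' * weightC Kd CU κU := fun j =>
    weightedColSum_le hpd hSB Δ₁ hCU0.le hκU0 hκ'0.le hκ'U hD1 j
  have hc0 : ∀ j, wCol Δ₀ ρd κ' j ≤ κ' * weightC Kd CU κU := fun j =>
    weightedColSum_le hpd hSB Δ₀ hCU0.le hκU0 hκ'0.le hκ'U hD0 j
  have hcB : ∀ j, wCol B ρd κ' j ≤ κ' * weightC Kd cb κU := fun j =>
    weightedColSum_le hpd hSB B hcb0 hκU0 hκ'0.le hκ'U hDB j
  -- ρ + ρ_B ≤ γ₀/2 < γ₀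
  have hsum : κ' * weightC Kd CU κU + κ' * weightC Kd cb κU ≤ γ₀ / 2 := by
    have hlin : κ' * weightC Kd CU κU + κ' * weightC Kd cb κU = κ' * weightC Kd (CU + cb) κU := by
      unfold weightC; ring
    rw [hlin]
    exact rate_mul_weightC_le hKd hγ₀pos (add_nonneg hCU0.le hcb0) hκU0
  have hγ : κ' * weightC Kd CU κU + κ' * weightC Kd cb κU < γ₀ := by linarith
  -- (c) the rate: sup-norm of the kernel of Δ₀ − Δ₁
  have hε0 : 0 ≤ thetaK a L k n * a := by
    have : 0 < aK a L k := lt_of_lt_of_le hamin hak1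
    have : 0 < aK a L n := lt_of_lt_of_le hamin (aminL_le_aK ha hL hn).1
    unfold thetaK; positivity
  have hEsup : ∀ z w, |(Δ₀ - Δ₁) z w| ≤ thetaK a L k n * a := fun z w => by
    rw [Matrix.sub_apply]
    exact effLaplacian_sub_apply_le ha hm hL hk hn M z w
  -- decay at the doubled Combes–Thomas rate `2κ′ ≤ κ_U`
  have h2κ : 2 * κ' ≤ κU := by linarith
  have hD1' : ∀ z w, |Δ₁ z w| ≤ CU * Real.exp (-(2 * κ' * ρd z w)) := fun z w =>
    (hD1 z w).trans (exp_decay_mono hCU0.le h2κ (hpd.nonneg z w))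
  have hD0' : ∀ z w, |Δ₀ z w| ≤ CU * Real.exp (-(2 * κ' * ρd z w)) := fun z w =>
    (hD0 z w).trans (exp_decay_mono hCU0.le h2κ (hpd.nonneg z w))
  -- (d) the lattice sums at rate κ′/2
  have hV : ∀ z, ∑ w, Real.exp (-(κ' / 2 * ρd z w)) ≤ Kd (κ' / 2) := fun z => hSB (κ' / 2) (by positivity) z
  -- LEMMA 4.5 (abstract engine)
  have h45 := lemma45_of_supRate Δ₁ Δ₀ B ρd hγ hκ'0.le hε0 h1 h0 hpd.symm hpd.zero hpd.triangle
    hr1 hr0 hrB hc1 hc0 hcB hEsup hD1' hD0' hV x y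
  refine h45.trans ?_
  -- constants: √(ε·2C_U) ≤ √(θ̄ a 2C_U)·L^{-k}, (γ₀ − ρ − ρ_B)⁻¹ ≤ 2/γ₀, V = K_d(κ′/2)
  have hθ : thetaK a L k n * a * (2 * CU) ≤ thetaBar a L * a * (2 * CU) * (((L : ℝ) ^ k) ^ 2)⁻¹ := by
    have := thetaK_le ha hL hk hn
    have h2CU : 0 ≤ a * (2 * CU) := by positivity
    calc thetaK a L k n * a * (2 * CU) = thetaK a L k n * (a * (2 * CU)) := by ring
      _ ≤ thetaBar a L * (((L : ℝ) ^ k) ^ 2)⁻¹ * (a * (2 * CU)) := mul_le_mul_of_nonneg_right this h2CU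
      _ = _ := by ring
  have hLk : (0 : ℝ) < (L : ℝ) ^ k := by positivity
  have hsqrt : Real.sqrt (thetaK a L k n * a * (2 * CU))
      ≤ Real.sqrt (thetaBar a L * a * (2 * CU)) * ((L : ℝ) ^ k)⁻¹ := by
    calc Real.sqrt (thetaK a L k n * a * (2 * CU))
        ≤ Real.sqrt (thetaBar a L * a * (2 * CU) * (((L : ℝ) ^ k) ^ 2)⁻¹) := Real.sqrt_le_sqrt hθ
      _ = Real.sqrt (thetaBar a L * a * (2 * CU)) * Real.sqrt ((((L : ℝ) ^ k) ^ 2)⁻¹) :=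
          Real.sqrt_mul' _ (by positivity)
      _ = Real.sqrt (thetaBar a L * a * (2 * CU)) * ((L : ℝ) ^ k)⁻¹ := by
          rw [Real.sqrt_inv, Real.sqrt_sq hLk.le]
  have hinv : (γ₀ - (κ' * weightC Kd CU κU + κ' * weightC Kd cb κU))⁻¹ ≤ 2 / γ₀ := by
    rw [div_eq_mul_inv, show (2 : ℝ) * γ₀⁻¹ = (γ₀ / 2)⁻¹ by rw [inv_div]; ring]
    exact inv_anti₀ (by positivity) (by linarith)
  have hinv0 : 0 ≤ (γ₀ - (κ' * weightC Kd CU κU + κ' * weightC Kd cb κU))⁻¹ := inv_nonneg.mpr (by linarith)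
  have hVnn : 0 ≤ Kd (κ' / 2) := hKd _ (by positivity)
  have e45 : K45 d a L * ((L : ℝ) ^ k)⁻¹ * Real.exp (-(delta45 d a L * tdistT (fine L M) x y))
      = (Real.sqrt (thetaBar a L * a * (2 * CU)) * ((L : ℝ) ^ k)⁻¹) * (2 / γ₀) ^ 2 * Kd (κ' / 2) ^ 2
        * Real.exp (-(κ' / 2 * ρd x y)) := by
    simp only [K45, delta45, V45, hCU, hκ', hγ₀, hρd, hamin_def]
    ring
  rw [e45]
  gcongr

/-- `δ₄₅ > 0`. [folklore] -/
theorem delta45_pos {a : ℝ} (ha : 0 < a) {L : ℕ} (hL : 2 ≤ L) : 0 < delta45 d a L := by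
  unfold delta45; have := (kapCT_pos_le (d := d) ha hL).1; positivity

/-- `K₄₅ ≥ 0`. [folklore] -/
theorem K45_nonneg (a : ℝ) (L : ℕ) : 0 ≤ K45 d a L := by
  unfold K45; positivity

/-- **Lemma 4.5 in King's printed shape** *"|C^{(k)}(x,y) − C^{(k+n)}(x,y)| ≤ CL^{−k}e^{−δ₀|x−y|}"*: there are
`C ≥ 0` and `δ₀ > 0` depending only on `a`, `L`, `d` such that the bound holds for all `k, n ≥ 1`, all `m² > 0`, all
tori and all sites (with the torus distance for `|x − y|`). [cite: King1986, Lemma 4.5 (4.38) p.674] -/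
theorem king_lemma45_torus_exists {a : ℝ} (ha : 0 < a) {L : ℕ} [NeZero L] (hL : 2 ≤ L) :
    ∃ C δ₀ : ℝ, 0 ≤ C ∧ 0 < δ₀ ∧ ∀ (m2 : ℝ), 0 < m2 → ∀ (k n : ℕ), 1 ≤ k → 1 ≤ n →
      ∀ (M : Fin d → ℕ) [∀ μ, NeZero (M μ)], ∀ x y : Tor (fine L M),
        |(effLaplacian (L ^ k) (fine L M) (aK a L k) (((L ^ k : ℕ) : ℝ) ^ 2) m2
              + (a * ((L : ℝ) ^ 2)⁻¹) • blockProj L M)⁻¹ x y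
          - (effLaplacian (L ^ n * L ^ k) (fine L M) (aK a L (k + n)) (((L ^ n * L ^ k : ℕ) : ℝ) ^ 2) m2
              + (a * ((L : ℝ) ^ 2)⁻¹) • blockProj L M)⁻¹ x y|
          ≤ C * ((L : ℝ) ^ k)⁻¹ * Real.exp (-(δ₀ * tdistT (fine L M) x y)) :=
  ⟨K45 d a L, delta45 d a L, K45_nonneg a L, delta45_pos ha hL,
    fun _ hm _ _ hk hn M _ x y => king_lemma45_torus ha hm hL hk hn M x y⟩

end Assembly


end Torus

end Literature.MathematicalPhysics.QuantumFieldTheory.King1986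

end
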